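import Summits.RiemannHypothesis.RiemannHypothesis.Theorems.PfPersistenceParityTransport
import Summits.RiemannHypothesis.RiemannHypothesis.Theorems.WeilWindowFlowWindowLipschitz
import Summits.RiemannHypothesis.RiemannHypothesis.Theorems.WeilWindowFlowGronwallLeakageStrictAnti
import Summits.RiemannHypothesis.RiemannHypothesis.Theorems.PfPersistenceDefectiveTransportShapeSectorAnyClock
import HarnessLib

/-!
# CALIBRATION of the parity-splitting transport T-P: its input is `NoParityCrossing` plus an
# ODD-SECTOR lower-Dini bound — the even half of the regularity is the PROVED `WindowLipschitz`
# (pub-rhpf, transport-1, leaf G1.22 'TRANSPORT', PART 11; RH-free glue; def-free)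

**mechanism/rigidity campaign; no RH claims.**  Companion text:
`run/shared/lean/pub/pub-rhpf/pub-rhpf-transport-1/TRANSPORT.md` §21 (T-P calibration).

`PfPersistenceParityTransport` (b6a360ca2c4e) derives the route items `NoParityCrossing` (18085),
`GroundStateSimpleEven` (1526), `EvenWinsBeyondArch` (15432) from ONE transport input: a Dini leakage bound for
the splitting `Q = ε_od − ε_ev` with a locally bounded rate on `[2/3, ∞)` (hypothesis `hD`, "T-P input").
This file decides the STRENGTH of that input, as `Cruxes/DiniLeakage` decided T-A's
(`DiniLeakage ↔ RH ∧ WindowLipschitz`; `WindowLipschitz` since PROVED, item 1039):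
* (111)–(113) **T-P input ⟺ `NoParityCrossing` ∧ (odd-sector lower-Dini bound)** — on every `[2/3, A)`
  some `L` such that at every `x`, for all `η, δ > 0`, SOME step `0 < h < δ` has
  `ε_od(x) − ε_od(x+h) ≤ h (L + η)`.  Forward: the even drop is `≥ 0` and `Q` has a positive minimum on
  `[2/3, A]` under `NoParityCrossing`; backward: T-P ⟹ `NoParityCrossing` (landed) ⟹ `ε = ε_ev` on
  `(0, ∞)` ⟹ the PROVED `WindowLipschitz_proof` bounds the even drop.
* (114)/(115) the odd-sector analogue of `WindowLipschitz` implies the lower-Dini bound: MODULO that one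
  regularity statement T-P's input is EXACTLY `NoParityCrossing`.  The tree's 28-file proof of
  `WindowLipschitz` (closed Markov form, weak Euler–Lagrange, Feulefack–Jarohs–Weth sup bound, IMS cut,
  barrier edge law) is keyed to `IsWeilGroundState` and the full bottom; its odd-sector transfer is NOT in
  the tree and NOT claimed.
* (98)–(104) RH-free by-products: under `NoParityCrossing` the order is strict at EVERY window and
  `ε = ε_ev`, so `ε_ev` is window-Lipschitz and STRICTLY decreasing on `(0, ∞)`; unconditionally on `(0, 2/3]`.
* (105)–(110) the bounded-clock residual of PART 10b typed at the parity level, RH-free: a FLAT PIECE of one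
  sector bottom forces the OTHER sector strictly below it there; so eventual concavity of `t ↦ ε_ev(ψ t)`
  along a BOUNDED non-decreasing non-constant clock forces a PARITY INVERSION `ε_od < ε_ev` on a plateau
  starting at or beyond `2/3`, while for `ε_od` it forces the strict order `ε_ev < ε_od` on the plateau —
  consistent, no contradiction known (the residual asymmetry of record).

Labels: every hypothesis named `hD` / `hod` / `hoL` / `hconc` below is an INPUT asserted of nothing (CONJ
for ζ where it concerns ζ); `NoParityCrossing` is an OPEN route item used only as a hypothesis or a
conclusion; everything else is PROVED tree material.  Nothing here is a step toward RH or toward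
`NoParityCrossing`; the file says what the T-P input IS.
-/

noncomputable section

set_option linter.dupNamespace false  -- D-0017 nested layout: `RiemannHypothesis.RiemannHypothesis`

namespace Summit.RiemannHypothesis.RiemannHypothesis.Theorems.PfPersistenceParityTransport

open Set Filter Topology
open _root_.Literature.NumberTheory.LFunctions
open _root_.Summit.RiemannHypothesis.RiemannHypothesis.Theses.WeilParity (NoParityCrossing)
open _root_.Summit.RiemannHypothesis.RiemannHypothesis.Theorems.EvenWinsBeyondArch
  (weilEvenGroundEnergy_lt_weilOddGroundEnergy_of_le_two_thirds beyond_two_thirds_of_noParityCrossing)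
open _root_.Summit.RiemannHypothesis.RiemannHypothesis.Theorems.WeilWindowFlowWindowLipschitz
  (WindowLipschitz_proof)
open _root_.Summit.RiemannHypothesis.RiemannHypothesis.Theorems.WeilWindowFlowGronwallLeakage
  (weilGroundEnergy_strictAntiOn)
open _root_.Summit.RiemannHypothesis.RiemannHypothesis.Theorems.PfPersistenceDefectiveTransport
  (clock_const_of_concaveOn_of_le)

/-! ## 1. Under `NoParityCrossing` the order is strict everywhere and `ε = ε_ev` -/

/-- (98) **`NoParityCrossing` ⟹ the strict parity order `ε_ev(a) < ε_od(a)` at EVERY window `a > 0`**: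
up to `2/3` it is proved outright (`…_of_le_two_thirds`); beyond, the splitting `Q = ε_od − ε_ev` is
continuous, positive at `2/3` and never zero, so it stays positive (intermediate value theorem). [folklore] -/
theorem splitting_pos_of_noParityCrossing (h : NoParityCrossing) {a : ℝ} (ha : 0 < a) :
    weilEvenGroundEnergy a < weilOddGroundEnergy a := by
  rcases le_or_gt a (2 / 3) with hle | hlt
  · exact weilEvenGroundEnergy_lt_weilOddGroundEnergy_of_le_two_thirds ha hle
  · refine not_le.1 fun hnot ↦ ?_
    have hcont : ContinuousOn (fun x ↦ weilOddGroundEnergy x - weilEvenGroundEnergy x)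
        (Icc (2 / 3 : ℝ) a) := continuousOn_splitting_Icc (by norm_num)
    have hQa : weilOddGroundEnergy a - weilEvenGroundEnergy a ≤ 0 := sub_nonpos.2 hnot
    have hQ0 : 0 < weilOddGroundEnergy (2 / 3) - weilEvenGroundEnergy (2 / 3) := splitting_pos_two_thirds
    have hmem : (0 : ℝ) ∈ Icc (weilOddGroundEnergy a - weilEvenGroundEnergy a)
        (weilOddGroundEnergy (2 / 3) - weilEvenGroundEnergy (2 / 3)) := ⟨hQa, hQ0.le⟩
    obtain ⟨c, hc, hQc⟩ := intermediate_value_Icc' hlt.le hcont hmem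
    rcases eq_or_lt_of_le hc.1 with h1 | hc23
    · exact hQ0.ne' (by rw [h1]; exact hQc)
    · exact beyond_two_thirds_of_noParityCrossing h c hc23 (sub_eq_zero.1 hQc).symm

/-- (99) **Under `NoParityCrossing`, `ε = ε_ev` on `(0, ∞)`** (`ε = min(ε_ev, ε_od)` and (98)). [folklore] -/
theorem weilGroundEnergy_eq_even_of_noParityCrossing (h : NoParityCrossing) {a : ℝ} (ha : 0 < a) :
    weilGroundEnergy a = weilEvenGroundEnergy a := by
  rw [weilGroundEnergy_eq_min_even_odd, min_eq_left (splitting_pos_of_noParityCrossing h ha).le]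

/-- (100) **RH-free: `ε = ε_ev` on `(0, 2/3]`** (the proved frontier). [folklore] -/
theorem weilGroundEnergy_eq_even_of_le_two_thirds {a : ℝ} (ha : 0 < a) (h23 : a ≤ 2 / 3) :
    weilGroundEnergy a = weilEvenGroundEnergy a := by
  rw [weilGroundEnergy_eq_min_even_odd,
    min_eq_left (weilEvenGroundEnergy_lt_weilOddGroundEnergy_of_le_two_thirds ha h23).le]

/-! ## 2. Even-sector regularity from the PROVED `WindowLipschitz` -/

/-- (101) **RH-free even-sector window-Lipschitz bound on every `[b₀, A] ⊂ (0, 2/3]`**: there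
`ε_ev = ε`, and `ε` is window-Lipschitz (`WindowLipschitz_proof`, item 1039). [folklore] -/
theorem evenWindowLipschitz_of_le_two_thirds {b₀ A : ℝ} (hb₀ : 0 < b₀) (hbA : b₀ ≤ A)
    (hA : A ≤ 2 / 3) :
    ∃ L : ℝ, ∀ b a : ℝ, b₀ ≤ b → b ≤ a → a ≤ A →
      weilEvenGroundEnergy b - weilEvenGroundEnergy a ≤ L * (a - b) := by
  obtain ⟨L, hL⟩ := WindowLipschitz_proof b₀ A hb₀ hbA
  refine ⟨L, fun b a hb hba haA ↦ ?_⟩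
  have hb0 : 0 < b := hb₀.trans_le hb
  rw [← weilGroundEnergy_eq_even_of_le_two_thirds hb0 (hba.trans (haA.trans hA)),
    ← weilGroundEnergy_eq_even_of_le_two_thirds (hb0.trans_le hba) (haA.trans hA)]
  exact hL b a hb hba haA

/-- (102) **Under `NoParityCrossing`, `ε_ev` is window-Lipschitz on every compact range of `(0, ∞)`**
(`ε_ev = ε` by (99), and `WindowLipschitz_proof`). [folklore] -/
theorem evenWindowLipschitz_of_noParityCrossing (h : NoParityCrossing) {b₀ A : ℝ} (hb₀ : 0 < b₀)
    (hbA : b₀ ≤ A) :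
    ∃ L : ℝ, ∀ b a : ℝ, b₀ ≤ b → b ≤ a → a ≤ A →
      weilEvenGroundEnergy b - weilEvenGroundEnergy a ≤ L * (a - b) := by
  obtain ⟨L, hL⟩ := WindowLipschitz_proof b₀ A hb₀ hbA
  refine ⟨L, fun b a hb hba haA ↦ ?_⟩
  have hb0 : 0 < b := hb₀.trans_le hb
  rw [← weilGroundEnergy_eq_even_of_noParityCrossing h hb0,
    ← weilGroundEnergy_eq_even_of_noParityCrossing h (hb0.trans_le hba)]
  exact hL b a hb hba haA

/-- (103) **RH-free: `ε_ev` is STRICTLY decreasing on `(0, 2/3]`** (`ε_ev = ε` there and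
`weilGroundEnergy_strictAntiOn`). [folklore] -/
theorem weilEvenGroundEnergy_strictAntiOn_Ioc_two_thirds :
    StrictAntiOn weilEvenGroundEnergy (Ioc 0 (2 / 3)) := by
  intro x hx y hy hxy
  rw [← weilGroundEnergy_eq_even_of_le_two_thirds hx.1 hx.2,
    ← weilGroundEnergy_eq_even_of_le_two_thirds hy.1 hy.2]
  exact weilGroundEnergy_strictAntiOn hx.1 hy.1 hxy

/-- (104) **Under `NoParityCrossing`, `ε_ev` is STRICTLY decreasing on `(0, ∞)`** ("even-sector
Bombieri" is a CONSEQUENCE of `NoParityCrossing`). [folklore] -/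
theorem weilEvenGroundEnergy_strictAntiOn_of_noParityCrossing (h : NoParityCrossing) :
    StrictAntiOn weilEvenGroundEnergy (Ioi 0) := by
  intro x hx y hy hxy
  have hx0 : 0 < x := hx
  have hy0 : 0 < y := hy
  rw [← weilGroundEnergy_eq_even_of_noParityCrossing h hx0,
    ← weilGroundEnergy_eq_even_of_noParityCrossing h hy0]
  exact weilGroundEnergy_strictAntiOn hx hy hxy

/-! ## 3. Flat pieces of a sector bottom and the bounded-clock residual of PART 10b (RH-free) -/

/-- (105) **An EVEN flat piece forces the ODD sector strictly below on it**: if `ε_ev(y) = ε_ev(x)` with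
`0 < x` then `ε_od(z) < ε_ev(z)` for every `z ∈ (x, y]` — because `ε = min(ε_ev, ε_od)` drops strictly
from `x` to `z` while `ε_ev` does not.  RH-free. [folklore] -/
theorem weilOddGroundEnergy_lt_even_of_even_flat {x y : ℝ} (hx : 0 < x)
    (hflat : weilEvenGroundEnergy y = weilEvenGroundEnergy x) :
    ∀ z ∈ Ioc x y, weilOddGroundEnergy z < weilEvenGroundEnergy z := by
  intro z hz
  have hz0 : 0 < z := hx.trans hz.1
  have h1 : weilGroundEnergy z < weilGroundEnergy x := weilGroundEnergy_strictAntiOn hx hz0 hz.1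
  have h2 : weilGroundEnergy x ≤ weilEvenGroundEnergy x := weilGroundEnergy_le_weilEvenGroundEnergy x
  have h3 : weilEvenGroundEnergy y ≤ weilEvenGroundEnergy z := weilEvenGroundEnergy_antitone hz0 hz.2
  have h4 : weilGroundEnergy z < weilEvenGroundEnergy z := by linarith
  rw [weilGroundEnergy_eq_min_even_odd] at h4
  exact (min_lt_iff.1 h4).resolve_left (lt_irrefl _)

/-- (106) **An ODD flat piece forces the EVEN sector strictly below on it**: if `ε_od(y) = ε_od(x)` with
`0 < x` then `ε_ev(z) < ε_od(z)` for every `z ∈ (x, y]`.  RH-free. [folklore] -/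
theorem weilEvenGroundEnergy_lt_odd_of_odd_flat {x y : ℝ} (hx : 0 < x)
    (hflat : weilOddGroundEnergy y = weilOddGroundEnergy x) :
    ∀ z ∈ Ioc x y, weilEvenGroundEnergy z < weilOddGroundEnergy z := by
  intro z hz
  have hz0 : 0 < z := hx.trans hz.1
  have h1 : weilGroundEnergy z < weilGroundEnergy x := weilGroundEnergy_strictAntiOn hx hz0 hz.1
  have h2 : weilGroundEnergy x ≤ weilOddGroundEnergy x := by
    rw [weilGroundEnergy_eq_min_even_odd]; exact min_le_right _ _
  have h3 : weilOddGroundEnergy y ≤ weilOddGroundEnergy z := weilOddGroundEnergy_antitone hz0 hz.2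
  have h4 : weilGroundEnergy z < weilOddGroundEnergy z := by linarith
  rw [weilGroundEnergy_eq_min_even_odd] at h4
  exact (min_lt_iff.1 h4).resolve_right (lt_irrefl _)

/-- (108) **An even flat piece lies beyond the proved frontier**: `ε_ev(y) = ε_ev(x)`, `0 < x < y`
⟹ `2/3 ≤ x` (else (105) contradicts the proved order at `min(y, 2/3)`).  RH-free. [folklore] -/
theorem two_thirds_le_of_even_flat {x y : ℝ} (hx : 0 < x) (hxy : x < y)
    (hflat : weilEvenGroundEnergy y = weilEvenGroundEnergy x) : 2 / 3 ≤ x := by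
  refine not_lt.1 fun hlt ↦ ?_
  have hz : min y (2 / 3) ∈ Ioc x y := ⟨lt_min hxy hlt, min_le_left _ _⟩
  have h1 := weilOddGroundEnergy_lt_even_of_even_flat hx hflat _ hz
  have h2 := weilEvenGroundEnergy_lt_weilOddGroundEnergy_of_le_two_thirds (hx.trans hz.1)
    (min_le_right _ _)
  exact lt_asymm h1 h2

/-- (107) **An even flat piece is a PARITY INVERSION beyond the frontier**: `ε_ev(y) = ε_ev(x)`,
`0 < x < y` ⟹ `2/3 ≤ x` and `ε_od < ε_ev` on `(x, y]` ((105) + (108)); in particular the parity order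
`ε_ev < ε_od` fails on a whole interval beyond `(log 3)/2` (contrapositive reading of (104): informal, the
route item is not targeted here).  RH-free. [folklore] -/
theorem parity_inversion_of_even_flat {x y : ℝ} (hx : 0 < x) (hxy : x < y)
    (hflat : weilEvenGroundEnergy y = weilEvenGroundEnergy x) :
    2 / 3 ≤ x ∧ ∀ z ∈ Ioc x y, weilOddGroundEnergy z < weilEvenGroundEnergy z :=
  ⟨two_thirds_le_of_even_flat hx hxy hflat, weilOddGroundEnergy_lt_even_of_even_flat hx hflat⟩

/-- (109) **Bounded clocks, EVEN sector (the PART 10b residual, typed RH-free).**  Let `ψ` be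
non-decreasing on `[t₀, ∞)` with `ψ t₀ > 0` and BOUNDED (`ψ t ≤ S`).  If `t ↦ ε_ev(ψ t)` is concave on
`[t₀, ∞)` then `ε_ev` is FROZEN along the clock — the floor needed by (91) `clock_const_of_concaveOn_of_le`
is automatic (`ε_ev(ψ t) ≥ ε_ev(S)`, antitone).  [folklore] -/
theorem even_clock_const_of_concaveOn_bdd {ψ : ℝ → ℝ} {t₀ S : ℝ} (hψ : MonotoneOn ψ (Ici t₀))
    (hψ0 : 0 < ψ t₀) (hS : ∀ t : ℝ, t₀ ≤ t → ψ t ≤ S)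
    (hconc : ConcaveOn ℝ (Ici t₀) (fun t : ℝ ↦ weilEvenGroundEnergy (ψ t))) :
    ∀ t : ℝ, t₀ ≤ t → weilEvenGroundEnergy (ψ t) = weilEvenGroundEnergy (ψ t₀) := by
  refine clock_const_of_concaveOn_of_le (m := weilEvenGroundEnergy S) weilEvenGroundEnergy_antitoneOn
    hψ hψ0 hconc fun t ht ↦ ?_
  have hψt : ψ t₀ ≤ ψ t := hψ self_mem_Ici ht ht
  exact weilEvenGroundEnergy_antitone (hψ0.trans_le hψt) (hS t ht)

/-- (109b) **… hence along a bounded NON-CONSTANT clock on which `ε_ev` is eventually concave the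
plateau starts at or beyond `2/3` and carries a PARITY INVERSION `ε_od < ε_ev` on `(ψ t₀, ψ t₁]`** — the
even-sector bounded-clock residual of PART 10b is thus `NoParityCrossing`-violating (informal reading; the
route item is not targeted), RH-free. [folklore] -/
theorem parity_inversion_of_concaveOn_even_clock_bdd {ψ : ℝ → ℝ} {t₀ t₁ S : ℝ}
    (hψ : MonotoneOn ψ (Ici t₀)) (hψ0 : 0 < ψ t₀) (hS : ∀ t : ℝ, t₀ ≤ t → ψ t ≤ S)
    (ht₁ : t₀ ≤ t₁) (hmove : ψ t₀ < ψ t₁)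
    (hconc : ConcaveOn ℝ (Ici t₀) (fun t : ℝ ↦ weilEvenGroundEnergy (ψ t))) :
    2 / 3 ≤ ψ t₀ ∧ ∀ z ∈ Ioc (ψ t₀) (ψ t₁), weilOddGroundEnergy z < weilEvenGroundEnergy z :=
  parity_inversion_of_even_flat hψ0 hmove (even_clock_const_of_concaveOn_bdd hψ hψ0 hS hconc t₁ ht₁)

/-- (110) **Bounded clocks, ODD sector.**  Same hypotheses for `t ↦ ε_od(ψ t)`: `ε_od` is frozen along
the clock, and on the plateau `(ψ t₀, ψ t₁]` the strict order `ε_ev < ε_od` holds — CONSISTENT with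
`NoParityCrossing`; no contradiction is known or claimed (the residual asymmetry of record). [folklore] -/
theorem odd_clock_const_of_concaveOn_bdd {ψ : ℝ → ℝ} {t₀ S : ℝ} (hψ : MonotoneOn ψ (Ici t₀))
    (hψ0 : 0 < ψ t₀) (hS : ∀ t : ℝ, t₀ ≤ t → ψ t ≤ S)
    (hconc : ConcaveOn ℝ (Ici t₀) (fun t : ℝ ↦ weilOddGroundEnergy (ψ t))) :
    (∀ t : ℝ, t₀ ≤ t → weilOddGroundEnergy (ψ t) = weilOddGroundEnergy (ψ t₀)) ∧
      ∀ t₁ : ℝ, t₀ ≤ t₁ → ∀ z ∈ Ioc (ψ t₀) (ψ t₁), weilEvenGroundEnergy z < weilOddGroundEnergy z := by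
  have hconst : ∀ t : ℝ, t₀ ≤ t → weilOddGroundEnergy (ψ t) = weilOddGroundEnergy (ψ t₀) := by
    refine clock_const_of_concaveOn_of_le (m := weilOddGroundEnergy S) weilOddGroundEnergy_antitoneOn
      hψ hψ0 hconc fun t ht ↦ ?_
    have hψt : ψ t₀ ≤ ψ t := hψ self_mem_Ici ht ht
    exact weilOddGroundEnergy_antitone (hψ0.trans_le hψt) (hS t ht)
  exact ⟨hconst, fun t₁ ht₁ ↦ weilEvenGroundEnergy_lt_odd_of_odd_flat hψ0 (hconst t₁ ht₁)⟩

/-! ## 4. THE CALIBRATION: T-P input ⟺ `NoParityCrossing` ∧ odd-sector lower-Dini bound -/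

/-- (111) **FORWARD: `NoParityCrossing` + the odd-sector lower-Dini bound ⟹ the T-P input.**  On
`[2/3, A]` the splitting `Q` is continuous and positive ((98)), so `q_A := min Q > 0`; the even drop
`ε_ev(x) − ε_ev(x+h)` is `≥ 0`; hence `Q(x) − Q(x+h) ≤ ε_od(x) − ε_od(x+h) ≤ h (L + η) ≤ h (K Q(x) + η)` with
`K = L⁺/q_A`.  The leakage clause `hod` is an INPUT asserted of nothing. [folklore] -/
theorem splittingLeakage_of_noParityCrossing_of_oddLowerDini (hN : NoParityCrossing)
    (hod : ∀ A : ℝ, 2 / 3 ≤ A → ∃ L : ℝ, ∀ x ∈ Ico (2 / 3 : ℝ) A, ∀ η δ : ℝ, 0 < η → 0 < δ →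
      ∃ h : ℝ, 0 < h ∧ h < δ ∧
        weilOddGroundEnergy x - weilOddGroundEnergy (x + h) ≤ h * (L + η)) :
    ∀ A : ℝ, 2 / 3 ≤ A → ∃ K : ℝ, ∀ x ∈ Ico (2 / 3 : ℝ) A, ∀ η δ : ℝ, 0 < η → 0 < δ →
      ∃ h : ℝ, 0 < h ∧ h < δ ∧
        (weilOddGroundEnergy x - weilEvenGroundEnergy x) -
            (weilOddGroundEnergy (x + h) - weilEvenGroundEnergy (x + h)) ≤
          h * (K * (weilOddGroundEnergy x - weilEvenGroundEnergy x) + η) := by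
  intro A hA
  obtain ⟨L, hL⟩ := hod A hA
  have hcont : ContinuousOn (fun x ↦ weilOddGroundEnergy x - weilEvenGroundEnergy x)
      (Icc (2 / 3 : ℝ) A) := continuousOn_splitting_Icc (by norm_num)
  obtain ⟨x₀, hx₀, hmin⟩ := isCompact_Icc.exists_isMinOn (nonempty_Icc.2 hA) hcont
  have hx₀0 : (0 : ℝ) < x₀ := lt_of_lt_of_le (by norm_num) hx₀.1
  have hq0 : 0 < weilOddGroundEnergy x₀ - weilEvenGroundEnergy x₀ :=
    sub_pos.2 (splitting_pos_of_noParityCrossing hN hx₀0)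
  refine ⟨max L 0 / (weilOddGroundEnergy x₀ - weilEvenGroundEnergy x₀), fun x hx η δ hη hδ ↦ ?_⟩
  obtain ⟨h, hh0, hhδ, hdrop⟩ := hL x hx η δ hη hδ
  refine ⟨h, hh0, hhδ, ?_⟩
  have hx0 : 0 < x := lt_of_lt_of_le (by norm_num) hx.1
  have hev : weilEvenGroundEnergy (x + h) ≤ weilEvenGroundEnergy x :=
    weilEvenGroundEnergy_antitone hx0 (by linarith)
  have hQx : weilOddGroundEnergy x₀ - weilEvenGroundEnergy x₀ ≤
      weilOddGroundEnergy x - weilEvenGroundEnergy x := (isMinOn_iff.1 hmin) x (Ico_subset_Icc_self hx)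
  have hK0 : 0 ≤ max L 0 / (weilOddGroundEnergy x₀ - weilEvenGroundEnergy x₀) :=
    div_nonneg (le_max_right _ _) hq0.le
  have hLK : L ≤ max L 0 / (weilOddGroundEnergy x₀ - weilEvenGroundEnergy x₀) *
      (weilOddGroundEnergy x - weilEvenGroundEnergy x) :=
    calc L ≤ max L 0 := le_max_left _ _
      _ = max L 0 / (weilOddGroundEnergy x₀ - weilEvenGroundEnergy x₀) *
            (weilOddGroundEnergy x₀ - weilEvenGroundEnergy x₀) := by
          rw [div_mul_cancel₀ _ hq0.ne']
      _ ≤ _ := mul_le_mul_of_nonneg_left hQx hK0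
  calc (weilOddGroundEnergy x - weilEvenGroundEnergy x) -
        (weilOddGroundEnergy (x + h) - weilEvenGroundEnergy (x + h))
      ≤ weilOddGroundEnergy x - weilOddGroundEnergy (x + h) := by linarith
    _ ≤ h * (L + η) := hdrop
    _ ≤ h * (max L 0 / (weilOddGroundEnergy x₀ - weilEvenGroundEnergy x₀) *
          (weilOddGroundEnergy x - weilEvenGroundEnergy x) + η) :=
        mul_le_mul_of_nonneg_left (by linarith) hh0.le

/-- (112) **BACKWARD: the T-P input ⟹ the odd-sector lower-Dini bound.**  T-P ⟹ `NoParityCrossing`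
(`noParityCrossing_of_splittingLeakage`, landed) ⟹ `ε = ε_ev` on `(0, ∞)` ((99)) ⟹ the even drop over
`[x, x+h] ⊂ [2/3, A+1]` is `≤ L h` by the PROVED `WindowLipschitz_proof`; and
`ε_od(x) − ε_od(x+h) = [Q(x) − Q(x+h)] + [ε_ev(x) − ε_ev(x+h)] ≤ h (K Q(x) + η) + L h` with
`0 ≤ Q(x) ≤ ε_od(2/3) − ε_ev(A)`.  The leakage clause `hD` is an INPUT asserted of nothing. [folklore] -/
theorem oddLowerDini_of_splittingLeakage
    (hD : ∀ A : ℝ, 2 / 3 ≤ A → ∃ K : ℝ, ∀ x ∈ Ico (2 / 3 : ℝ) A, ∀ η δ : ℝ, 0 < η → 0 < δ →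
      ∃ h : ℝ, 0 < h ∧ h < δ ∧
        (weilOddGroundEnergy x - weilEvenGroundEnergy x) -
            (weilOddGroundEnergy (x + h) - weilEvenGroundEnergy (x + h)) ≤
          h * (K * (weilOddGroundEnergy x - weilEvenGroundEnergy x) + η)) :
    ∀ A : ℝ, 2 / 3 ≤ A → ∃ L : ℝ, ∀ x ∈ Ico (2 / 3 : ℝ) A, ∀ η δ : ℝ, 0 < η → 0 < δ →
      ∃ h : ℝ, 0 < h ∧ h < δ ∧
        weilOddGroundEnergy x - weilOddGroundEnergy (x + h) ≤ h * (L + η) := by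
  have hN : NoParityCrossing := noParityCrossing_of_splittingLeakage hD
  intro A hA
  obtain ⟨K, hK⟩ := hD A hA
  obtain ⟨L, hL⟩ := WindowLipschitz_proof (2 / 3) (A + 1) (by norm_num) (by linarith)
  set B : ℝ := weilOddGroundEnergy (2 / 3) - weilEvenGroundEnergy A with hB
  refine ⟨max K 0 * max B 0 + max L 0, fun x hx η δ hη hδ ↦ ?_⟩
  obtain ⟨h, hh0, hhδ, hdrop⟩ := hK x hx η (min δ 1) hη (lt_min hδ one_pos)
  have hhδ' : h < δ := lt_of_lt_of_le hhδ (min_le_left _ _)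
  have hh1 : h < 1 := lt_of_lt_of_le hhδ (min_le_right _ _)
  refine ⟨h, hh0, hhδ', ?_⟩
  have hx0 : 0 < x := lt_of_lt_of_le (by norm_num) hx.1
  have hxh0 : 0 < x + h := by linarith
  have hevdrop : weilEvenGroundEnergy x - weilEvenGroundEnergy (x + h) ≤ L * h := by
    have h1 := hL x (x + h) hx.1 (by linarith) (by linarith [hx.2])
    rw [weilGroundEnergy_eq_even_of_noParityCrossing hN hx0,
      weilGroundEnergy_eq_even_of_noParityCrossing hN hxh0, show x + h - x = h by ring] at h1
    exact h1
  have hQpos : 0 ≤ weilOddGroundEnergy x - weilEvenGroundEnergy x :=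
    (sub_pos.2 (splitting_pos_of_noParityCrossing hN hx0)).le
  have hQle : weilOddGroundEnergy x - weilEvenGroundEnergy x ≤ max B 0 := by
    have h1 : weilOddGroundEnergy x ≤ weilOddGroundEnergy (2 / 3) :=
      weilOddGroundEnergy_antitone (by norm_num) hx.1
    have h2 : weilEvenGroundEnergy A ≤ weilEvenGroundEnergy x :=
      weilEvenGroundEnergy_antitone hx0 hx.2.le
    calc weilOddGroundEnergy x - weilEvenGroundEnergy x ≤ B := by rw [hB]; linarith
      _ ≤ max B 0 := le_max_left _ _
  have hKQ : K * (weilOddGroundEnergy x - weilEvenGroundEnergy x) ≤ max K 0 * max B 0 :=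
    calc K * (weilOddGroundEnergy x - weilEvenGroundEnergy x)
        ≤ max K 0 * (weilOddGroundEnergy x - weilEvenGroundEnergy x) :=
          mul_le_mul_of_nonneg_right (le_max_left _ _) hQpos
      _ ≤ max K 0 * max B 0 := mul_le_mul_of_nonneg_left hQle (le_max_right _ _)
  have hLh : L * h ≤ max L 0 * h := mul_le_mul_of_nonneg_right (le_max_left _ _) hh0.le
  have hsplit : weilOddGroundEnergy x - weilOddGroundEnergy (x + h) =
      ((weilOddGroundEnergy x - weilEvenGroundEnergy x) -
          (weilOddGroundEnergy (x + h) - weilEvenGroundEnergy (x + h))) +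
        (weilEvenGroundEnergy x - weilEvenGroundEnergy (x + h)) := by ring
  rw [hsplit]
  calc _ ≤ h * (K * (weilOddGroundEnergy x - weilEvenGroundEnergy x) + η) + L * h :=
        add_le_add hdrop hevdrop
    _ ≤ h * (max K 0 * max B 0 + η) + max L 0 * h :=
        add_le_add (mul_le_mul_of_nonneg_left (by linarith) hh0.le) hLh
    _ = h * (max K 0 * max B 0 + max L 0 + η) := by ring

/-- (113) **THE CALIBRATION.**  The T-P input (Dini leakage of the splitting with a locally bounded rate on
`[2/3, ∞)`, the hypothesis `hD` of `noParityCrossing_of_splittingLeakage`) is EQUIVALENT to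
`NoParityCrossing` together with the odd-sector lower-Dini bound — modulo PROVED tree theorems only
(`WindowLipschitz_proof`, the frontier `2/3`, sector continuity).  So T-P's input is
`NoParityCrossing`-STRENGTH up to one odd-sector regularity statement, exactly as T-A's `DiniLeakage` is
RH-strength up to `WindowLipschitz`.  Neither side is asserted. [folklore] -/
theorem splittingLeakage_iff_noParityCrossing_and_oddLowerDini :
    (∀ A : ℝ, 2 / 3 ≤ A → ∃ K : ℝ, ∀ x ∈ Ico (2 / 3 : ℝ) A, ∀ η δ : ℝ, 0 < η → 0 < δ →
      ∃ h : ℝ, 0 < h ∧ h < δ ∧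
        (weilOddGroundEnergy x - weilEvenGroundEnergy x) -
            (weilOddGroundEnergy (x + h) - weilEvenGroundEnergy (x + h)) ≤
          h * (K * (weilOddGroundEnergy x - weilEvenGroundEnergy x) + η)) ↔
    NoParityCrossing ∧
      (∀ A : ℝ, 2 / 3 ≤ A → ∃ L : ℝ, ∀ x ∈ Ico (2 / 3 : ℝ) A, ∀ η δ : ℝ, 0 < η → 0 < δ →
        ∃ h : ℝ, 0 < h ∧ h < δ ∧
          weilOddGroundEnergy x - weilOddGroundEnergy (x + h) ≤ h * (L + η)) :=
  ⟨fun hD ↦ ⟨noParityCrossing_of_splittingLeakage hD, oddLowerDini_of_splittingLeakage hD⟩,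
    fun h ↦ splittingLeakage_of_noParityCrossing_of_oddLowerDini h.1 h.2⟩

/-- (114) **The odd-sector analogue of `WindowLipschitz` implies the odd-sector lower-Dini bound** (take
the step `h = min(δ, 1)/2`).  The hypothesis `hoL` — `ε_od` window-Lipschitz on compact ranges — is NOT
in the tree (the 28-file proof of `WindowLipschitz` is keyed to the full bottom) and is asserted of
nothing here. [folklore] -/
theorem oddLowerDini_of_oddWindowLipschitz
    (hoL : ∀ b₀ A : ℝ, 0 < b₀ → b₀ ≤ A → ∃ L : ℝ, ∀ b a : ℝ, b₀ ≤ b → b ≤ a → a ≤ A →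
      weilOddGroundEnergy b - weilOddGroundEnergy a ≤ L * (a - b)) :
    ∀ A : ℝ, 2 / 3 ≤ A → ∃ L : ℝ, ∀ x ∈ Ico (2 / 3 : ℝ) A, ∀ η δ : ℝ, 0 < η → 0 < δ →
      ∃ h : ℝ, 0 < h ∧ h < δ ∧
        weilOddGroundEnergy x - weilOddGroundEnergy (x + h) ≤ h * (L + η) := by
  intro A hA
  obtain ⟨L, hL⟩ := hoL (2 / 3) (A + 1) (by norm_num) (by linarith)
  refine ⟨max L 0, fun x hx η δ hη hδ ↦ ?_⟩
  have hm : 0 < min δ 1 := lt_min hδ one_pos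
  have hh0 : 0 < min δ 1 / 2 := by positivity
  have hhδ : min δ 1 / 2 < δ := by have := min_le_left δ 1; linarith
  have hh1 : min δ 1 / 2 < 1 := by have := min_le_right δ 1; linarith
  refine ⟨min δ 1 / 2, hh0, hhδ, ?_⟩
  have h1 := hL x (x + min δ 1 / 2) hx.1 (by linarith) (by linarith [hx.2])
  calc weilOddGroundEnergy x - weilOddGroundEnergy (x + min δ 1 / 2)
      ≤ L * (x + min δ 1 / 2 - x) := h1
    _ = L * (min δ 1 / 2) := by ring
    _ ≤ max L 0 * (min δ 1 / 2) := mul_le_mul_of_nonneg_right (le_max_left _ _) hh0.le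
    _ ≤ min δ 1 / 2 * (max L 0 + η) := by nlinarith [le_max_right L 0]

/-- (115) **Modulo odd-sector window-Lipschitz regularity, the T-P input is EXACTLY `NoParityCrossing`.**
Both `hoL` and either side of the `↔` are asserted of nothing. [folklore] -/
theorem splittingLeakage_iff_noParityCrossing_of_oddWindowLipschitz
    (hoL : ∀ b₀ A : ℝ, 0 < b₀ → b₀ ≤ A → ∃ L : ℝ, ∀ b a : ℝ, b₀ ≤ b → b ≤ a → a ≤ A →
      weilOddGroundEnergy b - weilOddGroundEnergy a ≤ L * (a - b)) :
    (∀ A : ℝ, 2 / 3 ≤ A → ∃ K : ℝ, ∀ x ∈ Ico (2 / 3 : ℝ) A, ∀ η δ : ℝ, 0 < η → 0 < δ →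
      ∃ h : ℝ, 0 < h ∧ h < δ ∧
        (weilOddGroundEnergy x - weilEvenGroundEnergy x) -
            (weilOddGroundEnergy (x + h) - weilEvenGroundEnergy (x + h)) ≤
          h * (K * (weilOddGroundEnergy x - weilEvenGroundEnergy x) + η)) ↔
    NoParityCrossing :=
  ⟨noParityCrossing_of_splittingLeakage, fun h ↦
    splittingLeakage_of_noParityCrossing_of_oddLowerDini h (oddLowerDini_of_oddWindowLipschitz hoL)⟩

end Summit.RiemannHypothesis.RiemannHypothesis.Theorems.PfPersistenceParityTransport

end
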